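import Mathlib
import Summits.NavierStokesRegularity.NavierStokesRegularity.Theorems.TaoLadderRungTwoFlatNonlinearHopOn
import Summits.NavierStokesRegularity.NavierStokesRegularity.Theorems.TaoLadderRungTwoFlatFlowContinuity
import HarnessLib

/-!
# Linear ⇒ nonlinear hop estimate for a FORCED deviation ON A WINDOW, two gauges (junk race L8b-3 / (K3) on certificate
  windows) (helper for the transfer theorem stmt-NavierStokesRegularity-23909 `GradedAdiabaticWake`; route
  TaoLadderRungTwoFlat; cell harvest/h2-tao-ladder, p1 g21)

The WINDOW (`_Icc`) versions of `…NonlinearHopForced` / `…NonlinearHopForcedTwoGauge`: the reference `W` and the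
forced deviation `η` live on `[0,T]` only (`ContinuousOn` on `Icc 0 T`, `HasDerivAt` on `Ioo 0 T`), as exact graded
certificate flows do after the renormalised frame (`RenormFrame.pseudoFlowOnShift_renorm` +
`QuadPolar.hasDerivAt_of_pseudoFlowOnShift_exact`). The forcing `f` is the interface input of the core-truncated
deviation (`MirrorPulse.hasDerivAt_truncFam`, transported to the frame) plus, for child 2, the template residual.

* `gauge_forced_deviation_bound_Icc` — a priori: `w|η(s)| ≤ (B̃ + Fs)e^{L's}` on `[0,T]`;
* `gauge_linearisation_error_forced_Icc₂` — `ω|η − u|(s) ≤ (‖α‖₁A·R² + Fω)·s·e^{2‖α‖₁MΛ' s}` (`R = (B̃+FT)e^{L'T}`, `ω ≤ w`);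
* `nonlinear_hop_estimate_forced_Icc₂` — read-out at `T_r ∈ [0,T]`:
  `ω_{i,k}|η_{i,k+N}(T_r) − c₁v₁ − c₂v₂| ≤ ρB + Γ(‖α‖₁A·R² + Fω)T_r e^{2‖α‖₁MΛ'T_r}`.

HONEST FRAMING: elementary perturbation theory for MODEL lattices (Tao 2016 §4 vocabulary, shift-set parametrised); no
pulse is constructed, nothing is certified, nothing here is a statement about the Navier–Stokes equations.
-/

noncomputable section

-- the sub-problem namespace repeats the summit name by design (D-0017)
set_option linter.dupNamespace false

namespace Summit.NavierStokesRegularity.NavierStokesRegularity.Theorems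

open Set Filter Literature.Analysis.FluidPDE Literature.Analysis.FluidPDE.TaoCascade
open scoped Topology Nat

namespace QuadPolar

variable {m : ℕ}

/-- **A PRIORI GAUGE BOUND FOR A FORCED DEVIATION ON A WINDOW.** [cite: Tao2016AveragedNS, §4 (4.8); folklore (Duhamel–Gronwall)] -/
theorem gauge_forced_deviation_bound_Icc {𝕊 : Finset (ℤ × ℤ × ℤ)} (h𝕊 : IsNearestNeighbourSet 𝕊)
    (α : Fin m → Fin m → Fin m → ℤ × ℤ × ℤ → ℝ) {w : Fin m → ℤ → ℝ} {Λ : ℝ} (hw : IsWindowRegular w Λ)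
    {W η f : Fin m → ℤ → ℝ → ℝ} {M B F T : ℝ} (hWc : ∀ j k, ContinuousOn (W j k) (Icc 0 T))
    (hηc : ∀ j k, ContinuousOn (η j k) (Icc 0 T)) (hWb : ∀ j k, ∀ t ∈ Icc 0 T, |W j k t| ≤ M)
    (hXb : ∀ j k, ∀ t ∈ Icc 0 T, |(W + η) j k t| ≤ M) (hfc : ∀ j k, ContinuousOn (f j k) (Icc 0 T))
    (hfb : ∀ j k, ∀ t ∈ Icc 0 T, w j k * |f j k t| ≤ F) (hF : 0 ≤ F)
    (hη : ∀ i n, ∀ t ∈ Ioo 0 T, HasDerivAt (η i n)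
      (quadTermOn 𝕊 0 α (W + η) i n t - quadTermOn 𝕊 0 α W i n t + f i n t) t)
    (hB : ∀ i n, w i n * |η i n 0| ≤ B) (i : Fin m) (n : ℤ) {s : ℝ} (hs : s ∈ Icc 0 T) :
    w i n * |η i n s| ≤ (B + F * s) * Real.exp (2 * tableAbsSum 𝕊 α * M * Λ * s) := by
  set Φ : Fin m → ℤ → ℝ → ℝ := (1 / 2 : ℝ) • ((W + η) + W) with hΦ
  have hΦc : ∀ j k, ContinuousOn (Φ j k) (Icc 0 T) := fun j k => by
    have h : ContinuousOn (fun t => (1 / 2 : ℝ) * ((W j k t + η j k t) + W j k t)) (Icc 0 T) :=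
      continuousOn_const.mul (((hWc j k).add (hηc j k)).add (hWc j k))
    refine h.congr fun t _ => ?_
    simp only [hΦ, Pi.add_apply, Pi.smul_apply, smul_eq_mul]
  have hΦb : ∀ j k, ∀ t ∈ Icc 0 T, |Φ j k t| ≤ M := fun j k t ht => by
    have h1 := hXb j k t ht
    have h2 := hWb j k t ht
    have e : Φ j k t = (1 / 2 : ℝ) * ((W + η) j k t + W j k t) := by
      simp only [hΦ, Pi.add_apply, Pi.smul_apply, smul_eq_mul]
    rw [e, abs_mul, abs_of_pos (by norm_num : (0 : ℝ) < 1 / 2)]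
    linarith [abs_add_le ((W + η) j k t) (W j k t)]
  have hder : ∀ j k, ∀ t ∈ Ioo 0 T, HasDerivAt (η j k) (linTermOn 𝕊 0 α Φ η j k t + f j k t) t := by
    intro j k t ht
    refine (hη j k t ht).congr_deriv ?_
    have hmid := quadTermOn_sub_eq_linTermOn_mid 𝕊 0 α (W + η) W j k t
    have hsub : (W + η) - W = η := by funext a b c; simp
    rw [hsub] at hmid
    rw [hmid]
  have hηb : ∀ j k, ∀ t ∈ Icc 0 T, |η j k t| ≤ 2 * M := fun j k t ht => by
    have h1 := hXb j k t ht
    have h2 := hWb j k t ht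
    have e : η j k t = (W + η) j k t - W j k t := by simp
    rw [e]
    linarith [abs_sub ((W + η) j k t) (W j k t)]
  exact gauge_abs_le_forced_exp_Icc h𝕊 α hw hΦc hΦb hfc hfb hF hηc hder hηb hB i n hs

/-- **GAUGE LINEARISATION ERROR, FORCED, TWO GAUGES, ON A WINDOW.** [cite: Tao2016AveragedNS, §4 (4.8); folklore (Duhamel–Gronwall)] -/
theorem gauge_linearisation_error_forced_Icc₂ {𝕊 : Finset (ℤ × ℤ × ℤ)} (h𝕊 : IsNearestNeighbourSet 𝕊)
    (α : Fin m → Fin m → Fin m → ℤ × ℤ × ℤ → ℝ) {w ω : Fin m → ℤ → ℝ} {Λ Λ' A : ℝ} (hw : IsWindowRegular w Λ)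
    (hA : IsWindowAdmissible w A) (hω : IsWindowRegular ω Λ') (hωw : ∀ i k, ω i k ≤ w i k)
    {W η f u : Fin m → ℤ → ℝ → ℝ} {M Mu B F Fω T : ℝ}
    (hWc : ∀ j k, ContinuousOn (W j k) (Icc 0 T)) (hηc : ∀ j k, ContinuousOn (η j k) (Icc 0 T))
    (hWb : ∀ j k, ∀ t ∈ Icc 0 T, |W j k t| ≤ M) (hXb : ∀ j k, ∀ t ∈ Icc 0 T, |(W + η) j k t| ≤ M)
    (hfc : ∀ j k, ContinuousOn (f j k) (Icc 0 T)) (hfb : ∀ j k, ∀ t ∈ Icc 0 T, w j k * |f j k t| ≤ F) (hF : 0 ≤ F)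
    (hfω : ∀ j k, ∀ t ∈ Icc 0 T, ω j k * |f j k t| ≤ Fω) (hFω : 0 ≤ Fω)
    (hη : ∀ i n, ∀ t ∈ Ioo 0 T, HasDerivAt (η i n)
      (quadTermOn 𝕊 0 α (W + η) i n t - quadTermOn 𝕊 0 α W i n t + f i n t) t)
    (huc : ∀ i n, ContinuousOn (u i n) (Icc 0 T))
    (hu : ∀ i n, ∀ t ∈ Ioo 0 T, HasDerivAt (u i n) (linTermOn 𝕊 0 α W u i n t) t)
    (hub : ∀ i n, ∀ t ∈ Icc 0 T, |u i n t| ≤ Mu) (hu0 : ∀ i n, u i n 0 = η i n 0)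
    (hB : ∀ i n, w i n * |η i n 0| ≤ B) (i : Fin m) (n : ℤ) {s : ℝ} (hs : s ∈ Icc 0 T) :
    ω i n * |η i n s - u i n s| ≤
      (tableAbsSum 𝕊 α * A * ((B + F * T) * Real.exp (2 * tableAbsSum 𝕊 α * M * Λ * T)) ^ 2 + Fω) * s *
        Real.exp (2 * tableAbsSum 𝕊 α * M * Λ' * s) := by
  set ζ : Fin m → ℤ → ℝ → ℝ := fun j k t => η j k t - u j k t with hζ
  set g : Fin m → ℤ → ℝ → ℝ := fun j k t => quadTermOn 𝕊 0 α η j k t + f j k t with hg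
  set R : ℝ := (B + F * T) * Real.exp (2 * tableAbsSum 𝕊 α * M * Λ * T) with hR
  have hwpos := hw.1
  have hωpos := hω.1
  have hT : 0 ≤ T := hs.1.trans hs.2
  have hM : 0 ≤ M := (abs_nonneg _).trans (hWb i n 0 ⟨le_rfl, hT⟩)
  have hΛ : 0 ≤ Λ := le_trans zero_le_one hw.2.1
  have hB0 : 0 ≤ B := le_trans (mul_nonneg (hwpos i n).le (abs_nonneg _)) (hB i n)
  have hα := tableAbsSum_nonneg 𝕊 α
  have hR0 : 0 ≤ R := by rw [hR]; positivity
  have hηb : ∀ j k, ∀ t ∈ Icc 0 T, w j k * |η j k t| ≤ R := by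
    intro j k t ht
    have h := gauge_forced_deviation_bound_Icc h𝕊 α hw hWc hηc hWb hXb hfc hfb hF hη hB j k ht
    have hmono : Real.exp (2 * tableAbsSum 𝕊 α * M * Λ * t) ≤ Real.exp (2 * tableAbsSum 𝕊 α * M * Λ * T) :=
      Real.exp_le_exp.mpr (mul_le_mul_of_nonneg_left ht.2 (by positivity))
    have h2 : B + F * t ≤ B + F * T := by nlinarith [ht.2]
    have h3 : 0 ≤ B + F * t := by nlinarith [ht.1]
    calc w j k * |η j k t| ≤ (B + F * t) * Real.exp (2 * tableAbsSum 𝕊 α * M * Λ * t) := h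
      _ ≤ (B + F * T) * Real.exp (2 * tableAbsSum 𝕊 α * M * Λ * T) :=
          mul_le_mul h2 hmono (Real.exp_pos _).le (h3.trans h2)
      _ = R := by rw [hR]
  have hgc : ∀ j k, ContinuousOn (g j k) (Icc 0 T) := fun j k =>
    (continuousOn_quadTermOn 𝕊 0 α hηc j k).add (hfc j k)
  have hgb : ∀ j k, ∀ t ∈ Icc 0 T, ω j k * |g j k t| ≤ tableAbsSum 𝕊 α * A * R ^ 2 + Fω := fun j k t ht => by
    have h1 : w j k * |quadTermOn 𝕊 0 α η j k t| ≤ tableAbsSum 𝕊 α * A * R ^ 2 :=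
      gauge_abs_quadTermOn_le h𝕊 α hwpos hA hR0 fun j' k' _ => hηb j' k' t ht
    have h1' : ω j k * |quadTermOn 𝕊 0 α η j k t| ≤ tableAbsSum 𝕊 α * A * R ^ 2 :=
      (mul_le_mul_of_nonneg_right (hωw j k) (abs_nonneg _)).trans h1
    have h2 := hfω j k t ht
    have hω0 := (hωpos j k).le
    calc ω j k * |g j k t| ≤ ω j k * (|quadTermOn 𝕊 0 α η j k t| + |f j k t|) :=
          mul_le_mul_of_nonneg_left (abs_add_le _ _) hω0
      _ = ω j k * |quadTermOn 𝕊 0 α η j k t| + ω j k * |f j k t| := by ring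
      _ ≤ tableAbsSum 𝕊 α * A * R ^ 2 + Fω := add_le_add h1' h2
  have hG : 0 ≤ tableAbsSum 𝕊 α * A * R ^ 2 + Fω := by have := hA.1; positivity
  have hζc : ∀ j k, ContinuousOn (ζ j k) (Icc 0 T) := fun j k => (hηc j k).sub (huc j k)
  have hder : ∀ j k, ∀ t ∈ Ioo 0 T, HasDerivAt (ζ j k) (linTermOn 𝕊 0 α W ζ j k t + g j k t) t := by
    intro j k t ht
    have e1 : quadTermOn 𝕊 0 α (W + η) j k t - quadTermOn 𝕊 0 α W j k t =
        linTermOn 𝕊 0 α W η j k t + quadTermOn 𝕊 0 α η j k t := by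
      rw [quadTermOn_add_eq_lin]; ring
    have e2 : linTermOn 𝕊 0 α W ζ j k t = linTermOn 𝕊 0 α W η j k t - linTermOn 𝕊 0 α W u j k t := by
      have hζe : ζ = η + (-1 : ℝ) • u := by funext a b c; simp [hζ]; ring
      rw [hζe, linTermOn_add, linTermOn_smul]; ring
    have hd : HasDerivAt (ζ j k)
        ((quadTermOn 𝕊 0 α (W + η) j k t - quadTermOn 𝕊 0 α W j k t + f j k t)
          - linTermOn 𝕊 0 α W u j k t) t := (hη j k t ht).sub (hu j k t ht)
    refine hd.congr_deriv ?_
    rw [e1, e2, hg]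
    ring
  have hζb : ∀ j k, ∀ t ∈ Icc 0 T, |ζ j k t| ≤ 2 * M + Mu := fun j k t ht => by
    have h1 : |η j k t| ≤ 2 * M := by
      have e : η j k t = (W + η) j k t - W j k t := by simp
      rw [e]
      linarith [abs_sub ((W + η) j k t) (W j k t), hXb j k t ht, hWb j k t ht]
    exact (abs_sub _ _).trans (add_le_add h1 (hub j k t ht))
  have hζ0 : ∀ j k, ω j k * |ζ j k 0| ≤ 0 := fun j k => by simp [hζ, hu0 j k]
  have h := gauge_abs_le_forced_exp_Icc h𝕊 α hω hWc hWb hgc hgb hG hζc hder hζb hζ0 i n hs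
  rw [zero_add] at h
  calc ω i n * |η i n s - u i n s| = ω i n * |ζ i n s| := rfl
    _ ≤ (tableAbsSum 𝕊 α * A * R ^ 2 + Fω) * s * Real.exp (2 * tableAbsSum 𝕊 α * M * Λ' * s) := h

/-- **LINEAR ⇒ NONLINEAR HOP ESTIMATE, FORCED, TWO GAUGES, ON A WINDOW** (read-out at `T_r ∈ [0,T]`).
[cite: Tao2016AveragedNS, §4 (4.8) and §6.3–6.4 (statement shape); route TaoLadderRungTwoFlat, transfer lemma L8b-3 / (K3) on certificate windows] -/
theorem nonlinear_hop_estimate_forced_Icc₂ {𝕊 : Finset (ℤ × ℤ × ℤ)} (h𝕊 : IsNearestNeighbourSet 𝕊)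
    (α : Fin m → Fin m → Fin m → ℤ × ℤ × ℤ → ℝ) {w ω : Fin m → ℤ → ℝ} {Λ Λ' A Γ : ℝ} (hw : IsWindowRegular w Λ)
    (hA : IsWindowAdmissible w A) (hω : IsWindowRegular ω Λ') (hωw : ∀ i k, ω i k ≤ w i k) {N : ℤ}
    (hΓ : ∀ i k, ω i k ≤ Γ * ω i (k + N))
    {W η f : Fin m → ℤ → ℝ → ℝ} {v₁ v₂ : Fin m → ℤ → ℝ} {M T Tr ρ C B B' F Fω : ℝ} (hTr : Tr ∈ Icc 0 T)
    (hWc : ∀ j k, ContinuousOn (W j k) (Icc 0 T)) (hηc : ∀ j k, ContinuousOn (η j k) (Icc 0 T))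
    (hW : ∀ i n, ∀ t ∈ Ioo 0 T, HasDerivAt (W i n) (quadTermOn 𝕊 0 α W i n t) t)
    (hWb : ∀ i n, ∀ t ∈ Icc 0 T, |W i n t| ≤ M) (hXb : ∀ i n, ∀ t ∈ Icc 0 T, |(W + η) i n t| ≤ M)
    (hfc : ∀ j k, ContinuousOn (f j k) (Icc 0 T)) (hfb : ∀ j k, ∀ t ∈ Icc 0 T, w j k * |f j k t| ≤ F)
    (hF : 0 ≤ F) (hfω : ∀ j k, ∀ t ∈ Icc 0 T, ω j k * |f j k t| ≤ Fω) (hFω : 0 ≤ Fω)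
    (hη : ∀ i n, ∀ t ∈ Ioo 0 T, HasDerivAt (η i n)
      (quadTermOn 𝕊 0 α (W + η) i n t - quadTermOn 𝕊 0 α W i n t + f i n t) t)
    (hlin : ∀ u : Fin m → ℤ → ℝ → ℝ, (∀ i n, ContinuousOn (u i n) (Icc 0 T)) →
      (∀ i n, ∀ t ∈ Ioo 0 T, HasDerivAt (u i n) (linTermOn 𝕊 0 α W u i n t) t) →
      (∃ Mu : ℝ, ∀ i n, ∀ t ∈ Icc 0 T, |u i n t| ≤ Mu) → (∀ i k, ω i k * |u i k 0| ≤ B) →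
        ∃ c₁ c₂ : ℝ, |c₁| ≤ C * B ∧ |c₂| ≤ C * B ∧
          ∀ i k, ω i k * |u i (k + N) Tr - c₁ * v₁ i k - c₂ * v₂ i k| ≤ ρ * B)
    (hB : ∀ i k, ω i k * |η i k 0| ≤ B) (hB' : ∀ i k, w i k * |η i k 0| ≤ B') :
    ∃ c₁ c₂ : ℝ, |c₁| ≤ C * B ∧ |c₂| ≤ C * B ∧
      ∀ i k, ω i k * |η i (k + N) Tr - c₁ * v₁ i k - c₂ * v₂ i k| ≤
        ρ * B + Γ * ((tableAbsSum 𝕊 α * A * ((B' + F * T) * Real.exp (2 * tableAbsSum 𝕊 α * M * Λ * T)) ^ 2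
          + Fω) * Tr * Real.exp (2 * tableAbsSum 𝕊 α * M * Λ' * Tr)) := by
  have hT : 0 ≤ T := hTr.1.trans hTr.2
  have hd0 : ∀ i k, |(fun i k => η i k 0) i k| ≤ 2 * max M 0 := by
    intro i k
    have h1 := hXb i k 0 ⟨le_rfl, hT⟩
    have h2 := hWb i k 0 ⟨le_rfl, hT⟩
    have h3 := le_max_left M 0
    have e : η i k 0 = (W + η) i k 0 - W i k 0 := by simp
    show |η i k 0| ≤ 2 * max M 0
    rw [e]
    calc |(W + η) i k 0 - W i k 0| ≤ |(W + η) i k 0| + |W i k 0| := abs_sub _ _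
      _ ≤ 2 * max M 0 := by linarith
  obtain ⟨u, hu0, huc, hud, ⟨Mu, hub⟩⟩ := exists_variational_on_window 𝕊 α hT hWc hW hWb hd0
  have hucOn : ∀ i n, ContinuousOn (u i n) (Icc 0 T) := fun i n => (huc i n).continuousOn
  obtain ⟨c₁, c₂, hc₁, hc₂, hlinu⟩ := hlin u hucOn hud ⟨Mu, hub⟩ (fun i k => by rw [hu0]; exact hB i k)
  refine ⟨c₁, c₂, hc₁, hc₂, fun i k => ?_⟩
  have hu0' : ∀ i n, u i n 0 = η i n 0 := fun i n => hu0 i n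
  have herr := gauge_linearisation_error_forced_Icc₂ h𝕊 α hw hA hω hωw hWc hηc hWb hXb hfc hfb hF hfω hFω hη
    hucOn hud hub hu0' hB' i (k + N) hTr
  have hωpos : 0 < ω i (k + N) := hω.1 i (k + N)
  have hΓ0 : 0 ≤ Γ := by
    have h := (hω.1 i k).le.trans (hΓ i k)
    by_contra hneg
    push Not at hneg
    have : Γ * ω i (k + N) < 0 := mul_neg_of_neg_of_pos hneg hωpos
    linarith
  have htri : |η i (k + N) Tr - c₁ * v₁ i k - c₂ * v₂ i k| ≤
      |u i (k + N) Tr - c₁ * v₁ i k - c₂ * v₂ i k| + |η i (k + N) Tr - u i (k + N) Tr| := by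
    have e : η i (k + N) Tr - c₁ * v₁ i k - c₂ * v₂ i k =
        (u i (k + N) Tr - c₁ * v₁ i k - c₂ * v₂ i k) + (η i (k + N) Tr - u i (k + N) Tr) := by ring
    rw [e]; exact abs_add_le _ _
  have h2 : ω i k * |η i (k + N) Tr - u i (k + N) Tr| ≤
      Γ * ((tableAbsSum 𝕊 α * A * ((B' + F * T) * Real.exp (2 * tableAbsSum 𝕊 α * M * Λ * T)) ^ 2 + Fω)
        * Tr * Real.exp (2 * tableAbsSum 𝕊 α * M * Λ' * Tr)) := by
    calc ω i k * |η i (k + N) Tr - u i (k + N) Tr|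
        ≤ Γ * ω i (k + N) * |η i (k + N) Tr - u i (k + N) Tr| :=
          mul_le_mul_of_nonneg_right (hΓ i k) (abs_nonneg _)
      _ = Γ * (ω i (k + N) * |η i (k + N) Tr - u i (k + N) Tr|) := by ring
      _ ≤ _ := mul_le_mul_of_nonneg_left herr hΓ0
  calc ω i k * |η i (k + N) Tr - c₁ * v₁ i k - c₂ * v₂ i k|
      ≤ ω i k * (|u i (k + N) Tr - c₁ * v₁ i k - c₂ * v₂ i k| + |η i (k + N) Tr - u i (k + N) Tr|) :=
        mul_le_mul_of_nonneg_left htri (hω.1 i k).le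
    _ = ω i k * |u i (k + N) Tr - c₁ * v₁ i k - c₂ * v₂ i k| + ω i k * |η i (k + N) Tr - u i (k + N) Tr| := by
        ring
    _ ≤ _ := add_le_add (hlinu i k) h2

end QuadPolar

end Summit.NavierStokesRegularity.NavierStokesRegularity.Theorems

end
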